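import Summits.RiemannHypothesis.RiemannHypothesis.Theorems.WeilGroundStateGroundStatesConvergeToXiStubPhiIteratedDerivEnvelope
import Summits.RiemannHypothesis.RiemannHypothesis.Theorems.WeilGroundStateGroundStatesConvergeToXiStubHarmonicExtension
import Summits.RiemannHypothesis.RiemannHypothesis.Theorems.WeilGroundStateGroundStatesConvergeToXiWeakLimitHarmonic
import Summits.RiemannHypothesis.RiemannHypothesis.Theorems.WeilGroundStateGroundStatesConvergeToXiEnergyUpperTail
import Literature.NumberTheory.LFunctions.WeilOddThetaVector
import Mathlib.Analysis.Calculus.ContDiff.Bounds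
import Mathlib.Analysis.Calculus.IteratedDeriv.Lemmas
import HarnessLib

/-!
# The leakage kernel `Φ(1 - χ)` lies in the strong exponential Weil class
(crux `GroundBarta.GroundBartaFloor`, stmt-RiemannHypothesis-18389; line
`outer_cutoff_harmonic_pairing`, registered stub E `stub_leakageKernelEnvelope`)

For Riemann's kernel `Φ = weilThetaPhi` (`Φ(t) = 2Ψ(2t)`, `Φ̂ = ξ`) and ANY smooth compactly
supported real cut-off `χ`, the leakage kernel `κ = Φ · (1 - χ)` is smooth and every iterated
derivative is `O(e^{-|t|})`:

  `‖κ^{(k)}(t)‖ ≤ C_k e^{-|t|}`.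

Proof: Leibniz' bound `‖(fg)^{(k)}‖ ≤ Σ_i C(k,i) ‖f^{(i)}‖ ‖g^{(k-i)}‖`
(`norm_iteratedFDeriv_mul_le`) with `f = Φ` — all derivatives `O(e^{-|t|})`,
`stub_phi_iteratedDeriv_envelope` — and `g = 1 - χ`, all of whose derivatives are bounded
(`χ` is a test function: `hExt_strong_of_isWeilTest` at rate `0`; the constant `1` only enters at
order `0`).  Elementary; no published source needed. [folklore]
-/

set_option linter.dupNamespace false

noncomputable section

open Set MeasureTheory Filter Complex
open scoped Real Topology

namespace Summit.RiemannHypothesis.RiemannHypothesis.Theorems.GroundBartaFloor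

open Literature.NumberTheory.LFunctions
open Summit.RiemannHypothesis.RiemannHypothesis.Theorems.GroundStatesConvergeToXi

/-- Complex spelling of Riemann's kernel: `(Φ t : ℂ) = 2 Ψ(2t)`. [folklore] -/
theorem leakEnv_ofReal_weilThetaPhi (t : ℝ) :
    ((weilThetaPhi t : ℝ) : ℂ) = (2 : ℂ) * LagariasMontague.Psic (2 * t) := by
  rw [weilThetaPhi_eq_two_mul_Psi]
  simp [LagariasMontague.Psic]

/-- The leakage kernel as a product of two complex-valued smooth functions:
`(Φ(1-χ) : ℂ) = (2Ψ(2·)) · (1 - χ)`. [folklore] -/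
theorem leakEnv_eq_mul (χ : ℝ → ℝ) :
    (fun t : ℝ => ((weilThetaPhi t * (1 - χ t) : ℝ) : ℂ)) =
      fun t : ℝ => ((2 : ℂ) * LagariasMontague.Psic (2 * t)) * ((1 : ℂ) - (χ t : ℂ)) := by
  funext t
  rw [← leakEnv_ofReal_weilThetaPhi]
  push_cast
  ring

/-- Every iterated derivative of `1 - χ` is bounded, for a smooth compactly supported real `χ`.
[folklore] -/
theorem leakEnv_oneSub_bdd {χ : ℝ → ℝ} (hχ : ContDiff ℝ (⊤ : ℕ∞) χ)
    (hχs : HasCompactSupport χ) (j : ℕ) :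
    ∃ B : ℝ, 0 ≤ B ∧ ∀ t : ℝ, ‖iteratedDeriv j (fun t : ℝ => (1 : ℂ) - (χ t : ℂ)) t‖ ≤ B := by
  have htest : IsWeilTest fun t : ℝ => (χ t : ℂ) := isWeilTest_ofReal_comp hχ hχs
  obtain ⟨C, hC⟩ := hExt_strong_of_isWeilTest htest (le_refl (0 : ℝ)) j
  have hC' : ∀ t : ℝ, ‖iteratedDeriv j (fun t : ℝ => (χ t : ℂ)) t‖ ≤ C := fun t => by
    simpa using hC t
  have hC0 : 0 ≤ C := (norm_nonneg _).trans (hC' 0)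
  rcases Nat.eq_zero_or_pos j with hj | hj
  · subst hj
    refine ⟨1 + C, by positivity, fun t => ?_⟩
    rw [iteratedDeriv_zero]
    have h1 := hC' t
    rw [iteratedDeriv_zero] at h1
    calc ‖(1 : ℂ) - (χ t : ℂ)‖ ≤ ‖(1 : ℂ)‖ + ‖(χ t : ℂ)‖ := norm_sub_le _ _
      _ ≤ 1 + C := by rw [norm_one]; linarith
  · refine ⟨C, hC0, fun t => ?_⟩
    rw [iteratedDeriv_const_sub hj, iteratedDeriv_neg, norm_neg]
    exact hC' t

/-- Every iterated derivative of Riemann's kernel is `O(e^{-|t|})`, with a non-negative constant.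
[folklore] -/
theorem leakEnv_phi_envelope (i : ℕ) :
    ∃ C : ℝ, 0 ≤ C ∧ ∀ t : ℝ,
      ‖iteratedDeriv i (fun t : ℝ => (2 : ℂ) * LagariasMontague.Psic (2 * t)) t‖ ≤
        C * Real.exp (-(1 * |t|)) := by
  obtain ⟨C, hC⟩ := stub_phi_iteratedDeriv_envelope i
  refine ⟨max C 0, le_max_right _ _, fun t => (hC t).trans ?_⟩
  exact mul_le_mul_of_nonneg_right (le_max_left _ _) (Real.exp_pos _).le

/-- **Stub E — the leakage kernel lies in the exponential Weil class.**  For a smooth compactly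
supported real cut-off `χ`, `κ = Φ(1 - χ)` is smooth and every derivative is `O(e^{-|t|})`
(Leibniz with `stub_phi_iteratedDeriv_envelope`; `Φ = weilThetaPhi = 2Ψ(2·)`). [folklore] -/
theorem stub_leakageKernelEnvelope :
    ∀ χ : ℝ → ℝ, ContDiff ℝ (⊤ : ℕ∞) χ → HasCompactSupport χ →
      ContDiff ℝ (⊤ : ℕ∞) (fun t : ℝ => ((weilThetaPhi t * (1 - χ t) : ℝ) : ℂ)) ∧
      ∀ k : ℕ, ∃ C : ℝ, ∀ t : ℝ,
        ‖iteratedDeriv k (fun t : ℝ => ((weilThetaPhi t * (1 - χ t) : ℝ) : ℂ)) t‖ ≤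
          C * Real.exp (-(1 * |t|)) := by
  intro χ hχ hχs
  rw [leakEnv_eq_mul χ]
  have hf : ContDiff ℝ (⊤ : ℕ∞) (fun t : ℝ => (2 : ℂ) * LagariasMontague.Psic (2 * t)) :=
    contDiff_phi
  have hg : ContDiff ℝ (⊤ : ℕ∞) (fun t : ℝ => (1 : ℂ) - (χ t : ℂ)) :=
    contDiff_const.sub (Complex.ofRealCLM.contDiff.comp hχ)
  refine ⟨hf.mul hg, fun k => ?_⟩
  choose CΦ hCΦ0 hCΦ using leakEnv_phi_envelope
  choose B hB0 hB using leakEnv_oneSub_bdd hχ hχs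
  refine ⟨∑ i ∈ Finset.range (k + 1), (k.choose i : ℝ) * CΦ i * B (k - i), fun t => ?_⟩
  have hLeib := norm_iteratedFDeriv_mul_le (𝕜 := ℝ) hf hg t (n := k)
    (by exact_mod_cast le_top)
  rw [norm_iteratedFDeriv_eq_norm_iteratedDeriv] at hLeib
  refine hLeib.trans ?_
  rw [Finset.sum_mul]
  refine Finset.sum_le_sum fun i _ => ?_
  rw [norm_iteratedFDeriv_eq_norm_iteratedDeriv, norm_iteratedFDeriv_eq_norm_iteratedDeriv]
  have h1 := hCΦ i t
  have h2 := hB (k - i) t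
  have hchoose : (0 : ℝ) ≤ (k.choose i : ℝ) := Nat.cast_nonneg _
  calc (k.choose i : ℝ) * ‖iteratedDeriv i (fun t : ℝ => (2 : ℂ) * LagariasMontague.Psic (2 * t)) t‖ *
        ‖iteratedDeriv (k - i) (fun t : ℝ => (1 : ℂ) - (χ t : ℂ)) t‖
      ≤ (k.choose i : ℝ) * (CΦ i * Real.exp (-(1 * |t|))) * B (k - i) :=
        mul_le_mul (mul_le_mul_of_nonneg_left h1 hchoose) h2 (norm_nonneg _)
          (mul_nonneg hchoose (mul_nonneg (hCΦ0 i) (Real.exp_pos _).le))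
  _ = (k.choose i : ℝ) * CΦ i * B (k - i) * Real.exp (-(1 * |t|)) := by ring

end Summit.RiemannHypothesis.RiemannHypothesis.Theorems.GroundBartaFloor

end
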